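import Literature.Computability.AlgebraicComplexity.SupportRank
import Literature.Computability.AlgebraicComplexity.KroneckerRank
import Literature.Computability.AlgebraicComplexity.FlatteningBound
import Literature.Computability.AlgebraicComplexity.TensorRankFactsProofs
import HarnessLib

/-!
# Cohn–Umans 2013, Prop. 5: `(ℓ m n)^{ω_s/3} ≤ R_s(⟨ℓ,m,n⟩)` — proved (discharge of `SupportRank.lean`)

Topic `Literature/Computability/AlgebraicComplexity`. This sibling file of `SupportRank.lean`
PROVES the named fact `CohnUmans2013_prop_5` of that file, following the printed proof of
H. Cohn, C. Umans, *Fast matrix multiplication using coherent configurations*, SODA 2013 =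
arXiv:1207.6528, §3, Prop. 5 (p. 6 of the arXiv text) [CohnUmans2013]:

"Let `r = R_s(⟨ℓ,m,n⟩)` and `M = ℓmn`. By symmetrizing, we have `R_s(⟨M,M,M⟩) ≤ r³`, and then for
all `N ≥ 1`, by padding to the next largest power `Mⁱ` of `M`,
`R_s(⟨N,N,N⟩) ≤ R_s(⟨Mⁱ,Mⁱ,Mⁱ⟩) ≤ r^{3i} = (Mⁱ)^{3 log_M r} = O(N^{3 log_M r})`.
Thus, `ω_s ≤ 3 log_M r`, from which the theorem follows."

The architecture below mirrors it:

* The two ingredients named just before Def. 4 (p. 6) — "s-rank is … submultiplicative …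
  `R_s(T ⊗ T') ≤ R_s(T) R_s(T')`" and "`R_s(⟨ℓ,m,n⟩) = R_s(⟨ℓ',m',n'⟩)` for every permutation" —
  are `supportRank_kroneckerTensor_le` and `supportRank_matMulTensor_rotate_le` (the cyclic case,
  all that symmetrization needs), plus restriction `supportRank_precomp_le`. Each reduces to the
  tree's RANK statement (`Blaser2013_lemma58`, `tensorRank_rotate`, `tensorRank_precomp_le`,
  `kroneckerTensor_matMulTensor`, `matMulTensor_rotate`, `matMulTensor_eq_precomp_castLE` of
  `KroneckerRank.lean` / `FlatteningBound.lean` / `TensorRankFactsProofs.lean`), because a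
  same-support witness of `T` (`exists_sameSupport_tensorRank_eq`) rotates / restricts /
  multiplies to a same-support witness of the rotated / restricted / product tensor
  (`xy ≠ 0 ↔ x ≠ 0 ∧ y ≠ 0` in a field).
* "By symmetrizing, `R_s(⟨M,M,M⟩) ≤ r³`" = `supportRank_matMulTensor_cube_le`
  (`⟨ℓ,m,n⟩ ⊗ ⟨m,n,ℓ⟩ ⊗ ⟨n,ℓ,m⟩ ≅ ⟨M,M,M⟩`); "`≤ r^{3i}`" = `supportRank_matMulTensor_pow_le`;
  "by padding" = `supportRank_matMulTensor_mono`; "`= O(N^{3 log_M r})`" =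
  `logb_mem_sAdmissibleExponents` (verbatim the tree's `Blaser2013_logb_mem_admissibleExponents`
  with `R_s` for `R`: choose `i` with `Mⁱ⁻¹ ≤ N < Mⁱ`); "Thus `ω_s ≤ 3 log_M r`" =
  `omegaS_le_three_mul_logb_of_supportRank_le` (the infimum is genuine:
  `sAdmissibleExponents_bddBelow` of `SupportRank.lean`); "from which the theorem follows" =
  `rpow_omegaS_div_three_le_supportRank` (exponentiate; any field), and
  `CohnUmans2013_prop_5_holds` is the case `K = ℂ`.

The Lean statement ranges over all `ℓ m n : ℕ`: for `ℓmn = 0` it reads `0^{ω_s/3} ≤ 0`, true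
because `ω_s ≥ 2 > 0` (`omegaS_two_le`, the slice bound of `SupportRank.lean`); for `ℓmn = 1` it is
`1 ≤ R_s(⟨1,1,1⟩)` (`sq_le_supportRank_matMulTensor`); the case `r = 0` of the main step is vacuous
for the same reason (`R_s(⟨M,M,M⟩) ≥ M² ≥ 4`).

## References

* [CohnUmans2013] H. Cohn, C. Umans, *Fast matrix multiplication using coherent configurations*,
  SODA 2013, 1074–1087 = arXiv:1207.6528, §3: Def. 1, the paragraph before Def. 4, Prop. 5 and
  its proof (p. 6 of the arXiv text).
* [Blaser2013] M. Bläser, *Fast Matrix Multiplication*, Theory of Computing Graduate Surveys 5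
  (2013), Lemmas 5.3–5.5, 5.8, Thm. 5.9 (the rank versions, already proved in the tree).
-/

noncomputable section

open scoped BigOperators
open Filter Asymptotics

namespace Literature.Computability.AlgebraicComplexity

universe u

/-! ## s-rank under restriction, rotation and Kronecker product -/

section SRank

variable {K : Type u} [Field K] {ι κ μ ι' κ' μ' : Type*}
variable [Fintype ι] [Fintype κ] [Fintype μ] [Fintype ι'] [Fintype κ'] [Fintype μ']

/-- The minimum defining `R_s(t)` is attained: some tensor with the support of `t` has rank
exactly `R_s(t)` (the defining set contains `R(t)`, Cohn–Umans 2013, Def. 1).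
[cite: CohnUmans2013, Def. 1] -/
theorem exists_sameSupport_tensorRank_eq (t : ι → κ → μ → K) :
    ∃ t' : ι → κ → μ → K, SameSupport t t' ∧ tensorRank t' = supportRank t := by
  unfold supportRank
  exact Nat.sInf_mem (s := {r : ℕ | ∃ t' : ι → κ → μ → K, SameSupport t t' ∧ tensorRank t' = r})
    ⟨tensorRank t, t, SameSupport.refl t, rfl⟩

/-- **Restriction along index maps does not increase the s-rank**: `R_s(t ∘ (f × g × h)) ≤ R_s(t)`
(a same-support witness of `t` restricts to a same-support witness of the restriction, and
`R` does not increase: Bläser 2013, Lemma 5.4). Used for padding and relabelling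
(Cohn–Umans 2013, proof of Prop. 5, "by padding"). [cite: CohnUmans2013, Prop. 5 (proof)] -/
theorem supportRank_precomp_le (t : ι → κ → μ → K) (f : ι' → ι) (g : κ' → κ) (h : μ' → μ) :
    supportRank (fun a b c => t (f a) (g b) (h c)) ≤ supportRank t := by
  obtain ⟨t₁, ht, htr⟩ := exists_sameSupport_tensorRank_eq t
  calc supportRank (fun a b c => t (f a) (g b) (h c))
        ≤ tensorRank (fun a b c => t₁ (f a) (g b) (h c)) :=
          supportRank_le_of_sameSupport (t' := fun a b c => t₁ (f a) (g b) (h c))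
            (fun a b c => ht (f a) (g b) (h c)) le_rfl
    _ ≤ tensorRank t₁ := tensorRank_precomp_le t₁ f g h
    _ = supportRank t := htr

/-- **Cyclic rotation of the factors does not increase the s-rank** (Cohn–Umans 2013, before
Def. 4: `R_s(⟨ℓ,m,n⟩)` is invariant under permutations; here for any tensor, via Bläser 2013,
Lemma 5.3 on a same-support witness). [cite: CohnUmans2013, §3 (before Def. 4)] -/
theorem supportRank_rotate_le (t : ι → κ → μ → K) : supportRank (rotate t) ≤ supportRank t := by
  obtain ⟨t₁, ht, htr⟩ := exists_sameSupport_tensorRank_eq t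
  calc supportRank (rotate t) ≤ tensorRank (rotate t₁) :=
        supportRank_le_of_sameSupport (t' := rotate t₁) (fun b c a => ht a b c) le_rfl
    _ = tensorRank t₁ := tensorRank_rotate t₁
    _ = supportRank t := htr

/-- **s-rank is submultiplicative**: `R_s(s ⊗ t) ≤ R_s(s) R_s(t)` (Cohn–Umans 2013, before Def. 4:
"Like ordinary rank, s-rank is … submultiplicative"); the Kronecker product of same-support
witnesses is a same-support witness of the product since `xy ≠ 0 ↔ x ≠ 0 ∧ y ≠ 0` in a field, and
`R(s₁ ⊗ t₁) ≤ R(s₁) R(t₁)` (Bläser 2013, Lemma 5.8). [cite: CohnUmans2013, §3 (before Def. 4)] -/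
theorem supportRank_kroneckerTensor_le (s : ι → κ → μ → K) (t : ι' → κ' → μ' → K) :
    supportRank (kroneckerTensor s t) ≤ supportRank s * supportRank t := by
  obtain ⟨s₁, hs, hsr⟩ := exists_sameSupport_tensorRank_eq s
  obtain ⟨t₁, ht, htr⟩ := exists_sameSupport_tensorRank_eq t
  have hst : SameSupport (kroneckerTensor s t) (kroneckerTensor s₁ t₁) := fun a b c => by
    simp only [kroneckerTensor_apply, mul_ne_zero_iff]
    exact and_congr (hs _ _ _) (ht _ _ _)
  calc supportRank (kroneckerTensor s t) ≤ tensorRank (kroneckerTensor s₁ t₁) :=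
        supportRank_le_of_sameSupport hst le_rfl
    _ ≤ tensorRank s₁ * tensorRank t₁ := Blaser2013_lemma58 _ _
    _ = supportRank s * supportRank t := by rw [hsr, htr]

end SRank

/-! ## Matrix multiplication tensors: permutation, products, symmetrization, powers, padding -/

section MatMul

variable (K : Type u) [Field K]

/-- **`R_s(⟨m,n,k⟩) ≤ R_s(⟨k,m,n⟩)`** (Cohn–Umans 2013, before Def. 4: "`R_s(⟨ℓ,m,n⟩) =
R_s(⟨ℓ',m',n'⟩)` for every permutation"; the cyclic case, which is all the symmetrization needs):
`⟨m,n,k⟩` is the rotated `⟨k,m,n⟩` with two index sets transposed (Bläser 2013, p. 22).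
[cite: CohnUmans2013, §3 (before Def. 4)] -/
theorem supportRank_matMulTensor_rotate_le (k m n : ℕ) :
    supportRank (matMulTensor K m n k) ≤ supportRank (matMulTensor K k m n) := by
  have e : matMulTensor K m n k =
      fun b c a => rotate (matMulTensor K k m n) (Prod.swap b) (id c) (Prod.swap a) := by
    funext b c a
    rw [id, rotate_apply, matMulTensor_rotate K k m n b.swap c a.swap, Prod.swap_swap,
      Prod.swap_swap]
  rw [e]
  exact (supportRank_precomp_le (rotate (matMulTensor K k m n)) Prod.swap id Prod.swap).trans
    (supportRank_rotate_le _)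

/-- **`R_s(⟨kk', mm', nn'⟩) ≤ R_s(⟨k,m,n⟩) · R_s(⟨k',m',n'⟩)`**: the matrix multiplication tensors
multiply, `⟨k,m,n⟩ ⊗ ⟨k',m',n'⟩ ≅ ⟨kk',mm',nn'⟩` (Bläser 2013, p. 24; `kroneckerTensor_matMulTensor`),
and s-rank is submultiplicative (Cohn–Umans 2013, before Def. 4).
[cite: CohnUmans2013, §3 (before Def. 4)] -/
theorem supportRank_matMulTensor_mul_le (k m n k' m' n' : ℕ) :
    supportRank (matMulTensor K (k * k') (m * m') (n * n')) ≤
      supportRank (matMulTensor K k m n) * supportRank (matMulTensor K k' m' n') := by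
  have e : matMulTensor K (k * k') (m * m') (n * n') = fun a b c =>
      kroneckerTensor (matMulTensor K k m n) (matMulTensor K k' m' n')
        ((doubleIndexEquiv k n k' n').symm a) ((doubleIndexEquiv k m k' m').symm b)
        ((doubleIndexEquiv m n m' n').symm c) := by
    funext a b c
    rw [kroneckerTensor_matMulTensor]
    simp only [Equiv.apply_symm_apply]
  rw [e]
  exact (supportRank_precomp_le (kroneckerTensor (matMulTensor K k m n) (matMulTensor K k' m' n'))
    (doubleIndexEquiv k n k' n').symm (doubleIndexEquiv k m k' m').symm
    (doubleIndexEquiv m n m' n').symm).trans (supportRank_kroneckerTensor_le _ _)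

/-- **Symmetrization**: `R_s(⟨kmn, kmn, kmn⟩) ≤ R_s(⟨k,m,n⟩)³` (Cohn–Umans 2013, proof of Prop. 5:
"By symmetrizing, we have `R_s(⟨M,M,M⟩) ≤ r³`" — `⟨k,m,n⟩ ⊗ ⟨m,n,k⟩ ⊗ ⟨n,k,m⟩ ≅ ⟨kmn, mnk, nkm⟩`).
[cite: CohnUmans2013, Prop. 5 (proof)] -/
theorem supportRank_matMulTensor_cube_le (k m n : ℕ) :
    supportRank (matMulTensor K (k * m * n) (k * m * n) (k * m * n)) ≤
      supportRank (matMulTensor K k m n) ^ 3 := by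
  have h1 := supportRank_matMulTensor_mul_le K k m n m n k
  have h2 := supportRank_matMulTensor_mul_le K (k * m) (m * n) (n * k) n k m
  have r1 := supportRank_matMulTensor_rotate_le K k m n
  have r2 := (supportRank_matMulTensor_rotate_le K m n k).trans r1
  have hb : m * n * k = k * m * n := by ring
  have hc : n * k * m = k * m * n := by ring
  rw [hb, hc] at h2
  calc supportRank (matMulTensor K (k * m * n) (k * m * n) (k * m * n))
      ≤ supportRank (matMulTensor K (k * m) (m * n) (n * k)) *
          supportRank (matMulTensor K n k m) := h2
    _ ≤ supportRank (matMulTensor K k m n) * supportRank (matMulTensor K k m n) *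
          supportRank (matMulTensor K k m n) :=
        Nat.mul_le_mul (h1.trans (Nat.mul_le_mul le_rfl r1)) r2
    _ = supportRank (matMulTensor K k m n) ^ 3 := by ring

/-- **Powers**: `R_s(⟨Nⁱ, Nⁱ, Nⁱ⟩) ≤ R_s(⟨N,N,N⟩)ⁱ` (Cohn–Umans 2013, proof of Prop. 5:
`R_s(⟨Mⁱ,Mⁱ,Mⁱ⟩) ≤ r^{3i}`, iterating submultiplicativity). [cite: CohnUmans2013, Prop. 5 (proof)] -/
theorem supportRank_matMulTensor_pow_le (N i : ℕ) :
    supportRank (matMulTensor K (N ^ i) (N ^ i) (N ^ i)) ≤ supportRank (matMulTensor K N N N) ^ i := by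
  induction i with
  | zero =>
    rw [pow_zero, pow_zero]
    exact (supportRank_le_tensorRank (matMulTensor K 1 1 1)).trans
      ((tensorRank_matMulTensor_le K 1 1 1).trans (by norm_num))
  | succ i ih =>
    rw [pow_succ, pow_succ]
    exact (supportRank_matMulTensor_mul_le K (N ^ i) (N ^ i) (N ^ i) N N N).trans
      (Nat.mul_le_mul_right _ ih)

/-- **Padding**: `n ≤ m → R_s(⟨n,n,n⟩) ≤ R_s(⟨m,m,m⟩)` — `⟨n,n,n⟩` is the restriction of `⟨m,m,m⟩`
along the coordinate embeddings (Cohn–Umans 2013, proof of Prop. 5: "by padding to the next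
largest power"). [cite: CohnUmans2013, Prop. 5 (proof)] -/
theorem supportRank_matMulTensor_mono {n m : ℕ} (h : n ≤ m) :
    supportRank (matMulTensor K n n n) ≤ supportRank (matMulTensor K m m m) := by
  rw [matMulTensor_eq_precomp_castLE K h]
  exact supportRank_precomp_le (matMulTensor K m m m) _ _ _

end MatMul

/-! ## From an s-rank bound in one format to an s-admissible exponent; Prop. 5 -/

section OmegaS

variable (K : Type u) [Field K]

/-- **Interpolation step of the proof of Prop. 5**: if `R_s(⟨N,N,N⟩) ≤ q` with `N ≥ 2`, `q ≥ 1`,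
then `log_N q` is s-admissible, indeed `R_s(⟨n,n,n⟩) ≤ q · n^{log_N q}` for all `n ≥ 1` (choose `i`
with `Nⁱ⁻¹ ≤ n < Nⁱ`; `R_s(⟨n,n,n⟩) ≤ R_s(⟨Nⁱ,Nⁱ,Nⁱ⟩) ≤ qⁱ = (Nⁱ)^{log_N q} ≤ (Nn)^{log_N q}`;
Cohn–Umans 2013, proof of Prop. 5, "by padding to the next largest power … `= O(N^{3 log_M r})`").
[cite: CohnUmans2013, Prop. 5 (proof)] -/
theorem logb_mem_sAdmissibleExponents {N q : ℕ} (hN : 1 < N) (hq : 1 ≤ q)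
    (h : supportRank (matMulTensor K N N N) ≤ q) :
    Real.logb N q ∈ sAdmissibleExponents K := by
  set β : ℝ := Real.logb N q with hβ
  have hN0 : (0 : ℝ) < N := by exact_mod_cast (zero_lt_one.trans hN)
  have hN1 : (1 : ℝ) < N := by exact_mod_cast hN
  have hq0 : (0 : ℝ) < q := by exact_mod_cast hq
  have hβ0 : 0 ≤ β := Real.logb_nonneg hN1 (by exact_mod_cast hq)
  have hNβ : (N : ℝ) ^ β = q := Real.rpow_logb hN0 hN1.ne' hq0
  refine IsBigO.of_bound (q : ℝ) ?_
  filter_upwards [eventually_ge_atTop 1] with n hn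
  set S := Nat.log N n + 1 with hS
  have hlt : n < N ^ S := Nat.lt_pow_succ_log_self hN n
  have hle : N ^ S ≤ N * n := by
    rw [hS, pow_succ, mul_comm]
    exact Nat.mul_le_mul_left N (Nat.pow_log_le_self N (by omega))
  have hnat : supportRank (matMulTensor K n n n) ≤ q ^ S :=
    (supportRank_matMulTensor_mono K hlt.le).trans
      ((supportRank_matMulTensor_pow_le K N S).trans (Nat.pow_le_pow_left h S))
  have hn0 : (0 : ℝ) ≤ n := Nat.cast_nonneg _
  rw [Real.norm_of_nonneg (Nat.cast_nonneg _), Real.norm_of_nonneg (Real.rpow_nonneg hn0 _)]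
  calc (supportRank (matMulTensor K n n n) : ℝ) ≤ (q : ℝ) ^ S := by exact_mod_cast hnat
    _ = ((N ^ S : ℕ) : ℝ) ^ β := by
      rw [Nat.cast_pow, ← hNβ, ← Real.rpow_mul_natCast hN0.le, ← Real.rpow_natCast_mul hN0.le]
      congr 1
      exact mul_comm _ _
    _ ≤ ((N * n : ℕ) : ℝ) ^ β := Real.rpow_le_rpow (Nat.cast_nonneg _) (by exact_mod_cast hle) hβ0
    _ = q * (n : ℝ) ^ β := by rw [Nat.cast_mul, Real.mul_rpow hN0.le hn0, hNβ]

/-- **`ω_s ≤ 3 log_{kmn} r` whenever `R_s(⟨k,m,n⟩) ≤ r`** (`kmn > 1`) — the conclusion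
"Thus, `ω_s ≤ 3 log_M r`" of the proof of Cohn–Umans 2013, Prop. 5: symmetrization gives
`R_s(⟨M,M,M⟩) ≤ r³` (`M = kmn`), so `log_M r³ = 3 log_M r` is s-admissible by
`logb_mem_sAdmissibleExponents`, and `ω_s ≤` it since the s-admissible exponents are bounded
below (`sAdmissibleExponents_bddBelow`). (`r = 0` is vacuous: `R_s(⟨M,M,M⟩) ≥ M² ≥ 4`.)
[cite: CohnUmans2013, Prop. 5 (proof)] -/
theorem omegaS_le_three_mul_logb_of_supportRank_le (k m n r : ℕ) (hkmn : 1 < k * m * n)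
    (hr : supportRank (matMulTensor K k m n) ≤ r) :
    omegaS K ≤ 3 * Real.logb (k * m * n : ℕ) r := by
  have hcube : supportRank (matMulTensor K (k * m * n) (k * m * n) (k * m * n)) ≤ r ^ 3 :=
    (supportRank_matMulTensor_cube_le K k m n).trans (Nat.pow_le_pow_left hr 3)
  have hr1 : 1 ≤ r := by
    rcases Nat.eq_zero_or_pos r with rfl | h
    · exfalso
      have hsq := sq_le_supportRank_matMulTensor K (k * m * n)
      have h0 : (k * m * n) ^ 2 ≤ 0 := hsq.trans (by simpa using hcube)
      have hpos : 0 < (k * m * n) ^ 2 := pow_pos (Nat.zero_lt_of_lt hkmn) 2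
      omega
    · exact h
  have hmem := logb_mem_sAdmissibleExponents K hkmn (Nat.one_le_pow _ _ hr1) hcube
  have hlog : Real.logb ((k * m * n : ℕ) : ℝ) ((r ^ 3 : ℕ) : ℝ) =
      3 * Real.logb ((k * m * n : ℕ) : ℝ) (r : ℝ) := by
    rw [Nat.cast_pow, Real.logb_pow]
    push_cast
    ring
  rw [hlog] at hmem
  unfold omegaS
  exact csInf_le (sAdmissibleExponents_bddBelow K) hmem

/-- **Cohn–Umans 2013, Prop. 5, over any field**: `(ℓ m n)^{ω_s/3} ≤ R_s(⟨ℓ,m,n⟩)` for all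
`ℓ, m, n` ("from which the theorem follows": for `ℓmn ≥ 2` exponentiate
`omegaS_le_three_mul_logb_of_supportRank_le` with `r = R_s(⟨ℓ,m,n⟩) ≥ 1`; `ℓmn = 1`:
`1 ≤ R_s(⟨1,1,1⟩)`; `ℓmn = 0`: `0^{ω_s/3} = 0` as `ω_s ≥ 2`). [cite: CohnUmans2013, Prop. 5] -/
theorem rpow_omegaS_div_three_le_supportRank (l m n : ℕ) :
    ((l * m * n : ℕ) : ℝ) ^ (omegaS K / 3) ≤ (supportRank (matMulTensor K l m n) : ℝ) := by
  have hω : 0 < omegaS K / 3 := by linarith [omegaS_two_le K]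
  rcases Nat.lt_or_ge (l * m * n) 2 with hlt | hge
  · rcases Nat.lt_or_ge (l * m * n) 1 with h0 | h1
    · -- `ℓmn = 0`
      have h00 : l * m * n = 0 := by omega
      rw [h00, Nat.cast_zero, Real.zero_rpow hω.ne']
      exact Nat.cast_nonneg _
    · -- `ℓmn = 1`, so `ℓ = m = n = 1`
      have h11 : l * m * n = 1 := by omega
      obtain ⟨⟨rfl, rfl⟩, rfl⟩ := mul_eq_one.1 h11 |>.imp_left (fun h => mul_eq_one.1 h)
      rw [h11, Nat.cast_one, Real.one_rpow]
      exact_mod_cast sq_le_supportRank_matMulTensor K 1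
  · -- `ℓmn ≥ 2`: the printed argument
    have hM0 : (0 : ℝ) < (l * m * n : ℕ) := by exact_mod_cast (by omega : 0 < l * m * n)
    have hM1 : (1 : ℝ) < (l * m * n : ℕ) := by exact_mod_cast (by omega : 1 < l * m * n)
    have h3 := omegaS_le_three_mul_logb_of_supportRank_le K l m n _ hge le_rfl
    have hr0 : (0 : ℝ) < supportRank (matMulTensor K l m n) := by
      have hsq := sq_le_supportRank_matMulTensor K (l * m * n)
      have hcube := supportRank_matMulTensor_cube_le K l m n
      have hpos : 0 < (l * m * n) ^ 2 := pow_pos (by omega) 2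
      rcases Nat.eq_zero_or_pos (supportRank (matMulTensor K l m n)) with h0 | h0
      · exfalso
        have : (l * m * n) ^ 2 ≤ 0 := hsq.trans (hcube.trans (by simp [h0]))
        exact absurd this (not_le.2 hpos)
      · exact_mod_cast h0
    calc ((l * m * n : ℕ) : ℝ) ^ (omegaS K / 3)
        ≤ ((l * m * n : ℕ) : ℝ) ^ Real.logb (l * m * n : ℕ) (supportRank (matMulTensor K l m n)) :=
          Real.rpow_le_rpow_of_exponent_le hM1.le (by linarith)
      _ = supportRank (matMulTensor K l m n) := Real.rpow_logb hM0 hM1.ne' hr0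

end OmegaS

/-! ## Discharge -/

/-- DISCHARGE of the named fact `CohnUmans2013_prop_5` (`SupportRank.lean`) — **Cohn–Umans 2013,
Proposition 5**: "For all `ℓ, m, n`, we have `(ℓ m n)^{ω_s/3} ≤ R_s(⟨ℓ,m,n⟩)`" (over `ℂ`), the
case `K = ℂ` of `rpow_omegaS_div_three_le_supportRank`. [cite: CohnUmans2013, Prop. 5] -/
theorem CohnUmans2013_prop_5_holds : CohnUmans2013_prop_5 :=
  fun l m n => rpow_omegaS_div_three_le_supportRank ℂ l m n

end Literature.Computability.AlgebraicComplexity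

end
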